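import Mathlib
import HarnessLib

/-!
# Primes in a Noetherian local ring of embedding dimension at most one

Elementary local algebra [folklore] (Matsumura, *Commutative Ring Theory*, Thm. 11.2 and its proof:
a Noetherian local ring whose maximal ideal is principal and which is not Artinian is a discrete
valuation ring; Krull's intersection theorem, Mathlib `Ideal.iInf_pow_eq_bot_of_isLocalRing`), recorded
WITHOUT the domain hypothesis that Mathlib's `tfae_of_isNoetherianRing_of_isLocalRing_of_isDomain`
carries:

* `eq_bot_of_isPrime_of_ne_maximalIdeal_of_isPrincipal` — in a Noetherian local ring `(R, 𝔪)` with `𝔪`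
  principal, **every prime ideal other than `𝔪` is `⊥`**. Proof: write `𝔪 = (t)`; a prime `p ≠ 𝔪` does
  not contain `t`; if `0 ≠ x ∈ p`, Krull's intersection theorem gives `k` with `x ∈ 𝔪ᵏ ∖ 𝔪ᵏ⁺¹`, so
  `x = u tᵏ` with `u` a unit, whence `tᵏ ∈ p`, contradiction.
* the same with the hypothesis phrased as `dim_k 𝔪/𝔪² ≤ 1` (Mathlib
  `IsLocalRing.finrank_cotangentSpace_le_one_iff`), and the consequences: such a ring having a prime
  `p ≠ 𝔪` is a domain (`isDomain_of_isPrime_ne_maximalIdeal`) and a discrete valuation ring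
  (`isDiscreteValuationRing_of_isPrime_ne_maximalIdeal`).

Geometric reading (the use in a Hodge-locus census; H. Movasati, *Leaf schemes and Hodge loci*,
arXiv:2502.19988, Ch. 5 §8: on a parameter space `Λ` complementary to `V_Z` the conjecture becomes
"the Hodge locus `V_[Z]` is a smooth curve", and Thm. 5.3 there asserts smoothness of its truncations):
let `S = V_[Z] ∩ Λ` be a germ whose Zariski tangent space is one-dimensional (`R = 𝓞_{S,0}`,
`dim 𝔪/𝔪² = 1`) and which contains an irreducible curve germ `C` (a prime `p` of `R` with `R/p` of
dimension one, so `p ≠ 𝔪`). Then `p = ⊥`: **`S = C` scheme-theoretically**, and `R` is a discrete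
valuation ring, i.e. `S` is a smooth curve — to all orders, with no information on components of
`V_[Z]` not meeting `Λ` in positive dimension. HONEST FRAMING (cell pub-hlocus): certified instances and
evidence bearing on the general Hodge conjecture; no claim.
-/

namespace Literature.RingTheory.KrullDimension

open IsLocalRing

variable {R : Type*} [CommRing R] [IsNoetherianRing R] [IsLocalRing R]

/-- **In a Noetherian local ring with principal maximal ideal, every prime ideal other than the
maximal ideal is zero.** [folklore] -/
theorem eq_bot_of_isPrime_of_ne_maximalIdeal_of_isPrincipal (h : (maximalIdeal R).IsPrincipal)
    {p : Ideal R} (hp : p.IsPrime) (hpm : p ≠ maximalIdeal R) : p = ⊥ := by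
  classical
  haveI := h
  set t : R := Submodule.IsPrincipal.generator (maximalIdeal R) with ht_def
  have ht : Ideal.span {t} = maximalIdeal R := Ideal.span_singleton_generator _
  have hle : p ≤ maximalIdeal R := IsLocalRing.le_maximalIdeal hp.ne_top
  have htp : t ∉ p := by
    intro htp
    apply hpm
    refine le_antisymm hle ?_
    rw [← ht, Ideal.span_le, Set.singleton_subset_iff]
    exact htp
  refine (Submodule.eq_bot_iff _).mpr fun x hx => ?_
  by_contra hx0
  have hkrull : (⨅ n : ℕ, maximalIdeal R ^ n) = ⊥ :=
    Ideal.iInf_pow_eq_bot_of_isLocalRing _ (IsLocalRing.maximalIdeal.isMaximal R).ne_top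
  have hex : ∃ n : ℕ, x ∉ maximalIdeal R ^ n := by
    by_contra hall
    push Not at hall
    apply hx0
    have hmem : x ∈ (⨅ n : ℕ, maximalIdeal R ^ n) := Ideal.mem_iInf.mpr hall
    rwa [hkrull, Ideal.mem_bot] at hmem
  obtain ⟨n, hn, hmin⟩ : ∃ n, x ∉ maximalIdeal R ^ n ∧ ∀ k < n, x ∈ maximalIdeal R ^ k :=
    ⟨Nat.find hex, Nat.find_spec hex, fun k hk => not_not.mp (Nat.find_min hex hk)⟩
  have hn0 : n ≠ 0 := by
    rintro rfl
    exact hn (by simp)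
  obtain ⟨k, rfl⟩ := Nat.exists_eq_succ_of_ne_zero hn0
  have hxk : x ∈ maximalIdeal R ^ k := hmin k (Nat.lt_succ_self k)
  rw [← ht, Ideal.span_singleton_pow, Ideal.mem_span_singleton'] at hxk
  obtain ⟨u, hu⟩ := hxk
  have hu_unit : IsUnit u := by
    by_contra hnu
    have hum : u ∈ maximalIdeal R := (IsLocalRing.mem_maximalIdeal u).mpr hnu
    rw [← ht, Ideal.mem_span_singleton'] at hum
    obtain ⟨v, hv⟩ := hum
    apply hn
    rw [← ht, Ideal.span_singleton_pow, Ideal.mem_span_singleton']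
    refine ⟨v, ?_⟩
    calc v * t ^ (k + 1) = (v * t) * t ^ k := by ring
      _ = x := by rw [hv, hu]
  have htk : t ^ k ∈ p := by
    have hmem : (↑(hu_unit.unit⁻¹) : R) * x ∈ p := p.mul_mem_left _ hx
    rwa [← hu, ← mul_assoc, IsUnit.val_inv_mul, one_mul] at hmem
  rcases Nat.eq_zero_or_pos k with rfl | hk
  · exact hp.ne_top ((Ideal.eq_top_iff_one _).mpr (by simpa using htk))
  · exact htp (hp.mem_of_pow_mem k htk)

/-- The same with the hypothesis "embedding dimension `≤ 1`": if `dim_k 𝔪/𝔪² ≤ 1` then every prime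
`p ≠ 𝔪` is `⊥`. [folklore] -/
theorem eq_bot_of_isPrime_of_ne_maximalIdeal_of_finrank_cotangentSpace_le_one
    (h : Module.finrank (ResidueField R) (CotangentSpace R) ≤ 1) {p : Ideal R} (hp : p.IsPrime)
    (hpm : p ≠ maximalIdeal R) : p = ⊥ :=
  eq_bot_of_isPrime_of_ne_maximalIdeal_of_isPrincipal
    ((IsLocalRing.finrank_cotangentSpace_le_one_iff).mp h) hp hpm

/-- A Noetherian local ring with principal maximal ideal possessing a prime ideal `p ≠ 𝔪` is a domain
(namely `p = ⊥` is prime). [folklore] -/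
theorem isDomain_of_isPrime_ne_maximalIdeal (h : (maximalIdeal R).IsPrincipal) {p : Ideal R}
    (hp : p.IsPrime) (hpm : p ≠ maximalIdeal R) : IsDomain R := by
  have hbot := eq_bot_of_isPrime_of_ne_maximalIdeal_of_isPrincipal h hp hpm
  subst hbot
  haveI : IsDomain (R ⧸ (⊥ : Ideal R)) := (Ideal.Quotient.isDomain_iff_prime _).mpr hp
  exact (RingEquiv.quotientBot R).symm.isDomain

/-- … and then a discrete valuation ring (a regular local ring of dimension one): the germ is a smooth
curve. [folklore] -/
theorem isDiscreteValuationRing_of_isPrime_ne_maximalIdeal [IsDomain R]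
    (h : (maximalIdeal R).IsPrincipal) {p : Ideal R} (hp : p.IsPrime) (hpm : p ≠ maximalIdeal R) :
    IsDiscreteValuationRing R := by
  have hPIR : IsPrincipalIdealRing R :=
    ((tfae_of_isNoetherianRing_of_isLocalRing_of_isDomain R).out 4 0).mp h
  have hbot := eq_bot_of_isPrime_of_ne_maximalIdeal_of_isPrincipal h hp hpm
  exact { toIsPrincipalIdealRing := hPIR
          toIsLocalRing := inferInstance
          not_a_field' := fun hm => hpm (hbot.trans hm.symm) }

/-- **A germ of embedding dimension one containing a curve is that curve.** If `dim_k 𝔪/𝔪² ≤ 1` and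
`p ≠ 𝔪` is a prime of `R` (a positive-dimensional integral closed subgerm), then `R → R ⧸ p` is
bijective: the subgerm is everything. [folklore] -/
theorem quotientMk_bijective_of_finrank_cotangentSpace_le_one
    (h : Module.finrank (ResidueField R) (CotangentSpace R) ≤ 1) {p : Ideal R} (hp : p.IsPrime)
    (hpm : p ≠ maximalIdeal R) : Function.Bijective (Ideal.Quotient.mk p) := by
  have hbot := eq_bot_of_isPrime_of_ne_maximalIdeal_of_finrank_cotangentSpace_le_one h hp hpm
  subst hbot
  exact (RingEquiv.quotientBot R).symm.bijective

end Literature.RingTheory.KrullDimension
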